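import Literature.NumberTheory.Rogawski1990.ArchEndoscopicTransferContinuousGWall        -- ★ LH3-p04 (g2) p849710 (M2-01-curve): brings ★ p849548 (Δ-def-explicit), brick A, (C-bdry-glob); sibling ★ p849938 `…HWallOneSided` (one-sided version)
import HarnessLib

/-!
# (M3-link) The JUMP of `2 sin ψ · (Δ″-side of Θ)` across the `H`-wall in terms of the partners' one-sided limits: `G(0±) = (τ·D)(γ_H(z)) · Σ_ρ K_ρ · J±_ρ`
# (Rogawski 1990 §4.9 p. 55, §8.2 pp. 119–124; Shelstad 1979 §4; Varadarajan 1989 §6.4 Thms 18, 20, 22)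

Topic `NumberTheory/Rogawski1990`; namespace `Literature.NumberTheory.Rogawski1990`.  THEOREMS ONLY (no `def`, no instance, no notation, no axiom, no named fact, no `sorry`).
Cell `pub/hodgecm-mathlib`, line LH3 (closer stub `stub_N9`, crux H413 = `stmt-HodgeConjecture-24833`), `H`-side input of organ **(M3)** of LH3-plan (g2)'s D2′-SPEC §3∕§3b («H-WALL
`z₀ = z₂`: κ EQUAL across it, the jumps ADD: `2iκ(A)·(R′F)(D)(cayPt)` … = H-side stable jump `2i·Transf(insert w S)(cayPt)`»).  Companions: ★ p849710 (M2-01-curve: the `G`-walls,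
two-sided limits) and ★ `ArchEndoscopicTransferSmoothDefinitePlace` (the `H`-wall at a definite place, two-sided limits).  Here: the LINK form of ★ p849938∕★ `…HWallSharp` for the consumer of (M3): GIVEN the one-sided limits `J±_ρ` of the partners' functions
`g_ρ(ψ) = 2 sin ψ · ∫_{G′_∞} Θ(↑↑(g·t(z^ψ∘ρ)·g⁻¹)) dν_∞` (for the noncompact-wall partners these are the letter's (J-nc) data = `c·`(singular orbital integral on the wall centraliser),
for the compact ones `0`), the one-sided limits of `G` ARE `(τ·D_{G∕H})(γ_H(z)) · Σ_ρ K_ρ J±_ρ` with the wall point's OWN factor `τ(γ_H(z))·D_{G∕H,∞}(γ_H(z))` (non-zero: the `H`-root is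
not a `G∕H`-root) and the κ-constants `K_ρ = Π_v sgn(re σ_v α_{ρ_v⁻¹ 1})·η_v` — so the JUMP is `(τ·D)(γ_H(z)) · Σ_ρ K_ρ (Jp_ρ − Jm_ρ)`, every symbol explicit.

SETTING.  Base `z` regular off `w`, `z_{w,0} = z_{w,2} ≠ z_{w,1}`, curve `z^ψ = update z w (i ↦ z_{w,i}e^{i(1,0,−1)_iψ})`, `H`-point `γ_H(z^ψ)` (its 2-block eigenvalues `ζ₀e^{±iψ}`
coalesce at `ψ = 0`), partners `t(z^ψ∘ρ)`; `G(ψ) := 2 sin ψ · Σ_ρ Δ″(γ_H(z^ψ), t(z^ψ∘ρ))·∫_{G′_∞} Θ(↑↑(g·t(z^ψ∘ρ)·g⁻¹)) dν_∞` — the factor `2 sin ψ` is (up to a unit) the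
`H`-root factor `1 − e^{−i(c₀−c₂)}` of the normaliser `R_H`, which tames the `1∕ψ` growth of the unstable orbital integrals at a noncompact wall.

THE MATHEMATICS.  `Δ″_ρ = K_ρ·(τ·D)(γ_H(z^ψ))` (★ p849548) with `(τ·D)(ψ) = S(ψ) = C·(−((ζ₀²)^k(ζ₁ − ζ₀e^{iψ})(ζ₁ − ζ₀e^{−iψ}))∕ζ₁)` ENTIRE (`z₀z₂ = ζ₀²` constant on the curve); so
`G = S · Σ_ρ K_ρ g_ρ`, `g_ρ = 2 sin ψ·O_ρ` with three limits `Jp_ρ, Jm_ρ, D_ρ` for EVERY partner (noncompact `w`-wall: ★ (C-bdry-glob) p849626; compact: ★ brick A p849649,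
`Jp_ρ = Jm_ρ = 0`).  Hence `G(0±) = S(0)·Σ_ρ K_ρ J±_ρ` (a genuine jump) while `G′ = S′·H + S·H′ → 0·(bounded one-sided) + S(0)·Σ_ρ K_ρ D_ρ` from BOTH sides since
`S(ψ) = C·(−((ζ₀²)^k(ζ₁² + ζ₀² − ζ₀ζ₁(e^{iψ} + e^{−iψ})))∕ζ₁)` is even, `S′(0) = 0` (`deriv_comp_neg`).

WHAT IS PROVED.  **`tendsto_two_sin_mul_sum_archExplicitDelta_mul_integral_splitCurve_hWall_of_tendsto`** (+ `_aux`): from `g_ρ → J±_ρ` (`ψ → 0±`, every `ρ`) to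
`G → (τ(γ_H z)·D_{G∕H,∞}(γ_H z)) · Σ_ρ K_ρ J±_ρ`.
HONEST LABEL: HC_CM is proved only modulo the 7 printed citations (2 remaining: hLiu418 = stmt-HodgeConjecture-24832, h413 = stmt-HodgeConjecture-24833) until rung 0 closes; input of
(M3), pays nothing by itself.

## References
* [Rogawski1990] J. D. Rogawski, *Automorphic Representations of Unitary Groups in Three Variables*, Ann. of Math. Stud. 123 (1990), §4.9 p. 55, §8.2 pp. 119–124.
* [Shelstad1979] D. Shelstad, *Characters and inner forms of a quasi-split group over ℝ*, Compositio Math. 39 (1979), §4.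
* [Varadarajan1989] V. S. Varadarajan, *An Introduction to Harmonic Analysis on Semisimple Lie Groups* (1989), §6.4 Thm 18, Thm 20, Thm 22.
-/

set_option autoImplicit false

noncomputable section

open MeasureTheory Measure Filter Topology NumberField NumberField.InfinitePlace NumberField.mixedEmbedding Equiv Function Set
open Literature.MeasureTheory.Group Literature.NumberTheory.Automorphic Literature.NumberTheory.Automorphic.UnitaryGroup Literature.NumberTheory.GaloisRepresentations
open Literature.LinearAlgebra.Matrix
open scoped Matrix MatrixGroups Matrix.Norms.Operator ContDiff ComplexConjugate

namespace Literature.NumberTheory.Rogawski1990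

section HWall

variable (L : Type) [Field L] [NumberField L] [IsCMField L] (α : Fin 3 → L) (w : {w : InfinitePlace L // IsComplex w})
  [MeasurableSpace (GL (Fin 3) ℂ)] [BorelSpace (GL (Fin 3) ℂ)]
  [MeasurableSpace (arch (↥(maximalRealSubfield L)) L (IsCMField.complexConj L) 3 (Matrix.diagonal α))] [BorelSpace (arch (↥(maximalRealSubfield L)) L (IsCMField.complexConj L) 3 (Matrix.diagonal α))]

variable
  (γH : ({w : InfinitePlace L // IsComplex w} → Fin 3 → Circle) →
    ↥(UnitaryGroup.arch (↥(maximalRealSubfield L)) L (IsCMField.complexConj L) 2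
        (Matrix.of fun i j : Fin 2 => if i.val + j.val + 1 = 2 then (1 : L) else 0)) ×
      ↥(UnitaryGroup.arch (↥(maximalRealSubfield L)) L (IsCMField.complexConj L) 1
        (Matrix.of fun i j : Fin 1 => if i.val + j.val + 1 = 1 then (1 : L) else 0)))
  (hγH : γH = fun z =>
    ((UnitaryGroup.archPiEquivCM 2 L (Matrix.of fun i j : Fin 2 => if i.val + j.val + 1 = 2 then (1 : L) else 0)).symm fun w =>
        ⟨Matrix.GeneralLinearGroup.mkOfDetNeZero !![(1 : ℂ), 1; 1, -1] UnitaryGroup.det_cayleyTwo_ne_zero *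
            UnitaryGroup.circleDiagonal 2 ![z w 0, z w 2] *
          (Matrix.GeneralLinearGroup.mkOfDetNeZero !![(1 : ℂ), 1; 1, -1] UnitaryGroup.det_cayleyTwo_ne_zero)⁻¹,
          UnitaryGroup.cayley_conj_circleDiagonal_mem_archLocal L w _⟩,
      (UnitaryGroup.archPiEquivCM 1 L (Matrix.of fun i j : Fin 1 => if i.val + j.val + 1 = 1 then (1 : L) else 0)).symm fun w =>
        ⟨UnitaryGroup.circleDiagonal 1 ![z w 1], UnitaryGroup.circleDiagonal_mem_archLocal_antidiagOne L w _⟩))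
  (μ : HeckeCharacter L)

omit [BorelSpace (GL (Fin 3) ℂ)] [BorelSpace (arch (↥(maximalRealSubfield L)) L (IsCMField.complexConj L) 3 (Matrix.diagonal α))] in
include hγH in
open scoped Classical in
/-- (M3-link) with the curve as an equality binder (proof engine; instantiate with `rfl`). [cite: Rogawski1990, §8.2 pp. 122–124] [cite: Shelstad1979, §4] [cite: Varadarajan1989, §6.4 Thm 18, Thm 20, Thm 22] -/
theorem tendsto_two_sin_mul_sum_archExplicitDelta_mul_integral_splitCurve_hWall_of_tendsto_aux
    (νw : ∀ v : {w : InfinitePlace L // IsComplex w}, Measure (archLocal L 3 (Matrix.diagonal α) v)) [∀ v, (νw v).IsHaarMeasure]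
    (hμω : ∀ x : ideleGroup ↥(maximalRealSubfield L), μ (AdeleRing.ideleBaseChange (↥(maximalRealSubfield L)) L x) = quadraticHeckeCharCM L x)
    (Θ : Matrix (Fin 3) (Fin 3) (mixedSpace L) → ℂ)
    (z : {w : InfinitePlace L // IsComplex w} → Fin 3 → Circle) (h02 : z w 0 = z w 2)
    (c : ℝ → Fin 3 → Circle) (hc : c = fun ψ i => z w i * Circle.exp (![(1 : ℝ), 0, -1] i * ψ))
    (Jp Jm : ({w : InfinitePlace L // IsComplex w} → Perm (Fin 3)) → ℂ)
    (hJp : ∀ ρ : {w : InfinitePlace L // IsComplex w} → Perm (Fin 3), Tendsto (fun ψ : ℝ => (2 * Real.sin ψ : ℂ) *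
          ∫ g, Θ (((g * archDiagTorus L 3 α (fun v => Function.update z w (c ψ) v ∘ ⇑(ρ v)) * g⁻¹ :
            arch (↥(maximalRealSubfield L)) L (IsCMField.complexConj L) 3 (Matrix.diagonal α)) : GL (Fin 3) (mixedSpace L)) : Matrix (Fin 3) (Fin 3) (mixedSpace L))
            ∂((Measure.pi νw).map (archPiEquivCM 3 L (Matrix.diagonal α)).symm)) (𝓝[>] 0) (𝓝 (Jp ρ)))
    (hJm : ∀ ρ : {w : InfinitePlace L // IsComplex w} → Perm (Fin 3), Tendsto (fun ψ : ℝ => (2 * Real.sin ψ : ℂ) *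
          ∫ g, Θ (((g * archDiagTorus L 3 α (fun v => Function.update z w (c ψ) v ∘ ⇑(ρ v)) * g⁻¹ :
            arch (↥(maximalRealSubfield L)) L (IsCMField.complexConj L) 3 (Matrix.diagonal α)) : GL (Fin 3) (mixedSpace L)) : Matrix (Fin 3) (Fin 3) (mixedSpace L))
            ∂((Measure.pi νw).map (archPiEquivCM 3 L (Matrix.diagonal α)).symm)) (𝓝[<] 0) (𝓝 (Jm ρ))) :
    Tendsto (fun ψ : ℝ => (2 * Real.sin ψ : ℂ) * ∑ ρ : {w : InfinitePlace L // IsComplex w} → Perm (Fin 3),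
          archExplicitDelta L (Matrix.diagonal α) (γH fun v => Function.update z w (c ψ) v) μ (archDiagTorus L 3 α fun v => Function.update z w (c ψ) v ∘ ⇑(ρ v)) *
            ∫ g, Θ (((g * archDiagTorus L 3 α (fun v => Function.update z w (c ψ) v ∘ ⇑(ρ v)) * g⁻¹ :
              arch (↥(maximalRealSubfield L)) L (IsCMField.complexConj L) 3 (Matrix.diagonal α)) : GL (Fin 3) (mixedSpace L)) : Matrix (Fin 3) (Fin 3) (mixedSpace L))
              ∂((Measure.pi νw).map (archPiEquivCM 3 L (Matrix.diagonal α)).symm)) (𝓝[>] 0)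
        (𝓝 ((archTau L (γH z) μ * (archWeylRatio L (γH z) : ℂ)) * ∑ ρ : {w : InfinitePlace L // IsComplex w} → Perm (Fin 3), ((∏ v : {w : InfinitePlace L // IsComplex w}, ((SignType.sign ((v.1.embedding (α ((ρ v).symm 1))).re) : ℤ) * archMajoritySign L (Matrix.diagonal α) v) : ℤ) : ℂ) * Jp ρ)) ∧
      Tendsto (fun ψ : ℝ => (2 * Real.sin ψ : ℂ) * ∑ ρ : {w : InfinitePlace L // IsComplex w} → Perm (Fin 3),
          archExplicitDelta L (Matrix.diagonal α) (γH fun v => Function.update z w (c ψ) v) μ (archDiagTorus L 3 α fun v => Function.update z w (c ψ) v ∘ ⇑(ρ v)) *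
            ∫ g, Θ (((g * archDiagTorus L 3 α (fun v => Function.update z w (c ψ) v ∘ ⇑(ρ v)) * g⁻¹ :
              arch (↥(maximalRealSubfield L)) L (IsCMField.complexConj L) 3 (Matrix.diagonal α)) : GL (Fin 3) (mixedSpace L)) : Matrix (Fin 3) (Fin 3) (mixedSpace L))
              ∂((Measure.pi νw).map (archPiEquivCM 3 L (Matrix.diagonal α)).symm)) (𝓝[<] 0)
        (𝓝 ((archTau L (γH z) μ * (archWeylRatio L (γH z) : ℂ)) * ∑ ρ : {w : InfinitePlace L // IsComplex w} → Perm (Fin 3), ((∏ v : {w : InfinitePlace L // IsComplex w}, ((SignType.sign ((v.1.embedding (α ((ρ v).symm 1))).re) : ℤ) * archMajoritySign L (Matrix.diagonal α) v) : ℤ) : ℂ) * Jm ρ)) := by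
  -- ABBREVIATIONS (opaque, with defining equations): the orbital function `g_ρ`, the sign product `K_ρ`
  obtain ⟨G, hG⟩ : ∃ G : ({w : InfinitePlace L // IsComplex w} → Perm (Fin 3)) → ℝ → ℂ, G = fun (ρ : {w : InfinitePlace L // IsComplex w} → Perm (Fin 3)) (ψ : ℝ) => (2 * Real.sin ψ : ℂ) *
      ∫ g, Θ (((g * archDiagTorus L 3 α (fun v => Function.update z w (c ψ) v ∘ ⇑(ρ v)) * g⁻¹ :
        arch (↥(maximalRealSubfield L)) L (IsCMField.complexConj L) 3 (Matrix.diagonal α)) : GL (Fin 3) (mixedSpace L)) : Matrix (Fin 3) (Fin 3) (mixedSpace L))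
        ∂((Measure.pi νw).map (archPiEquivCM 3 L (Matrix.diagonal α)).symm) := ⟨_, rfl⟩
  obtain ⟨K, hK⟩ : ∃ K : ({w : InfinitePlace L // IsComplex w} → Perm (Fin 3)) → ℤ, ∀ ρ, K ρ =
      (∏ v : {w : InfinitePlace L // IsComplex w}, ((SignType.sign ((v.1.embedding (α ((ρ v).symm 1))).re) : ℤ) * archMajoritySign L (Matrix.diagonal α) v)) :=
    ⟨fun ρ => _, fun ρ => rfl⟩
  have hGρ : ∀ ρ : {w : InfinitePlace L // IsComplex w} → Perm (Fin 3), G ρ = fun ψ : ℝ => (2 * Real.sin ψ : ℂ) *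
      ∫ g, Θ (((g * archDiagTorus L 3 α (fun v => Function.update z w (fun i => z w i * Circle.exp (![(1 : ℝ), 0, -1] i * ψ)) v ∘ ⇑(ρ v)) * g⁻¹ :
        arch (↥(maximalRealSubfield L)) L (IsCMField.complexConj L) 3 (Matrix.diagonal α)) : GL (Fin 3) (mixedSpace L)) : Matrix (Fin 3) (Fin 3) (mixedSpace L))
        ∂((Measure.pi νw).map (archPiEquivCM 3 L (Matrix.diagonal α)).symm) := by
    intro ρ; subst hc hG; rfl
  have hcψ : ∀ ψ : ℝ, c ψ = fun i => z w i * Circle.exp (![(1 : ℝ), 0, -1] i * ψ) := fun ψ => by subst hc; rfl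
  -- (2) THE LAURENT FORM OF `τ·D` ALONG THE CURVE: `= S(ψ)` with `S` entire (no zero at the `H`-wall: `z₀z₂ = ζ₀²` is constant)
  obtain ⟨k, hk⟩ := exists_archTau_mul_archWeylRatio_cayleyTorus_eq L γH hγH μ hμω
  obtain ⟨Cst, hCst⟩ : ∃ Cst : ℂ, Cst = (∏ v ∈ Finset.univ.erase w, -((((z v 0 : ℂ) * (z v 2 : ℂ)) ^ (k v)) * (((z v 1 : ℂ) - (z v 0 : ℂ)) * ((z v 1 : ℂ) - (z v 2 : ℂ))) / (z v 1 : ℂ))) :=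
    ⟨_, rfl⟩
  obtain ⟨S, hS⟩ : ∃ S : ℝ → ℂ, S = fun ψ : ℝ => Cst * -(((((z w 0 : ℂ) * (z w 0 : ℂ)) ^ (k w)) *
      ((((z w 1 : ℂ) - (z w 0 : ℂ) * Complex.exp (ψ * Complex.I)) * ((z w 1 : ℂ) - (z w 0 : ℂ) * Complex.exp (-(ψ * Complex.I)))))) / (z w 1 : ℂ)) := ⟨_, rfl⟩
  have hS_smooth : ContDiff ℝ (⊤ : ℕ∞) S := by
    have h1 : ContDiff ℝ (⊤ : ℕ∞) (fun ψ : ℝ => (ψ : ℂ)) := Complex.ofRealCLM.contDiff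
    have hA : ContDiff ℝ (⊤ : ℕ∞) (fun ψ : ℝ => Complex.exp (ψ * Complex.I)) := Complex.contDiff_exp.comp (h1.mul contDiff_const)
    have hB : ContDiff ℝ (⊤ : ℕ∞) (fun ψ : ℝ => Complex.exp (-(ψ * Complex.I))) := Complex.contDiff_exp.comp (h1.mul contDiff_const).neg
    rw [hS]
    simp only [div_eq_mul_inv]
    exact contDiff_const.mul ((contDiff_const.mul ((contDiff_const.sub (contDiff_const.mul hA)).mul (contDiff_const.sub (contDiff_const.mul hB)))).mul contDiff_const).neg
  have hc0 : ∀ ψ : ℝ, ((c ψ 0 : Circle) : ℂ) = (z w 0 : ℂ) * Complex.exp (ψ * Complex.I) := by intro ψ; subst hc; simp [Circle.coe_exp]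
  have hc1 : ∀ ψ : ℝ, ((c ψ 1 : Circle) : ℂ) = (z w 1 : ℂ) := by intro ψ; subst hc; simp
  have hc2 : ∀ ψ : ℝ, ((c ψ 2 : Circle) : ℂ) = (z w 0 : ℂ) * Complex.exp (-(ψ * Complex.I)) := by intro ψ; subst hc; simp [Circle.coe_exp, h02, Complex.exp_neg]
  have hT : ∀ ψ : ℝ, archTau L (γH fun v => Function.update z w (c ψ) v) μ * (archWeylRatio L (γH fun v => Function.update z w (c ψ) v) : ℂ) = S ψ := by
    intro ψ
    rw [hk, ← Finset.mul_prod_erase Finset.univ _ (Finset.mem_univ w), Function.update_self, hc0, hc1, hc2,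
      Finset.prod_congr rfl fun v hv => by rw [Function.update_of_ne (Finset.ne_of_mem_erase hv)], hS, hCst]
    have he : Complex.exp (ψ * Complex.I) * Complex.exp (-(ψ * Complex.I)) = 1 := by rw [← Complex.exp_add, add_neg_cancel, Complex.exp_zero]
    have hsq : ((z w 0 : ℂ) * Complex.exp (ψ * Complex.I)) * ((z w 0 : ℂ) * Complex.exp (-(ψ * Complex.I))) = (z w 0 : ℂ) * (z w 0 : ℂ) := by
      linear_combination ((z w 0 : ℂ) * (z w 0 : ℂ)) * he
    rw [hsq]
    ring
  -- (3) `Δ″`-TERMS AND `G = S · H`, `H = Σ_ρ K_ρ g_ρ`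
  have hΔ : ∀ (ρ : {w : InfinitePlace L // IsComplex w} → Perm (Fin 3)) (ψ : ℝ),
      archExplicitDelta L (Matrix.diagonal α) (γH fun v => Function.update z w (c ψ) v) μ (archDiagTorus L 3 α fun v => Function.update z w (c ψ) v ∘ ⇑(ρ v)) =
        (K ρ : ℂ) * S ψ := by
    intro ρ ψ
    rw [archExplicitDelta_cayleyTorus_relabel_eq_mul L α γH hγH μ (fun v => Function.update z w (c ψ) v) ρ, hT ψ, hK ρ]
  have hF : (fun ψ : ℝ => (2 * Real.sin ψ : ℂ) * ∑ ρ : {w : InfinitePlace L // IsComplex w} → Perm (Fin 3),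
          archExplicitDelta L (Matrix.diagonal α) (γH fun v => Function.update z w (c ψ) v) μ (archDiagTorus L 3 α fun v => Function.update z w (c ψ) v ∘ ⇑(ρ v)) *
            ∫ g, Θ (((g * archDiagTorus L 3 α (fun v => Function.update z w (c ψ) v ∘ ⇑(ρ v)) * g⁻¹ :
              arch (↥(maximalRealSubfield L)) L (IsCMField.complexConj L) 3 (Matrix.diagonal α)) : GL (Fin 3) (mixedSpace L)) : Matrix (Fin 3) (Fin 3) (mixedSpace L))
              ∂((Measure.pi νw).map (archPiEquivCM 3 L (Matrix.diagonal α)).symm)) =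
      fun ψ => S ψ * ∑ ρ : {w : InfinitePlace L // IsComplex w} → Perm (Fin 3), (K ρ : ℂ) * G ρ ψ := by
    funext ψ
    rw [Finset.mul_sum, Finset.mul_sum]
    refine Finset.sum_congr rfl fun ρ _ => ?_
    rw [hΔ ρ ψ, hG]
    ring
  rw [hF]
  -- the hypotheses, read on the opaque `G`
  have hJp' : ∀ ρ, Tendsto (G ρ) (𝓝[>] 0) (𝓝 (Jp ρ)) := fun ρ => by rw [hG]; exact hJp ρ
  have hJm' : ∀ ρ, Tendsto (G ρ) (𝓝[<] 0) (𝓝 (Jm ρ)) := fun ρ => by rw [hG]; exact hJm ρ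
  -- `S 0 = τ(γ_H z)·D(γ_H z)` (the curve passes through `z` at `ψ = 0`)
  have hc0z : Function.update z w (c 0) = z := by
    rw [hcψ 0]
    have h : (fun i => z w i * Circle.exp (![(1 : ℝ), 0, -1] i * 0)) = z w := by funext i; simp
    rw [h, Function.update_eq_self]
  have hS0v : S 0 = archTau L (γH z) μ * (archWeylRatio L (γH z) : ℂ) := by
    rw [← hT 0]
    simp only [hc0z]
  have hS0 : Tendsto S (𝓝[≠] 0) (𝓝 (S 0)) := (hS_smooth.continuous.tendsto 0).mono_left nhdsWithin_le_nhds
  have hGT : (𝓝[>] (0 : ℝ)) ≤ 𝓝[≠] 0 := nhdsWithin_mono _ fun x hx => ne_of_gt hx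
  have hLT : (𝓝[<] (0 : ℝ)) ≤ 𝓝[≠] 0 := nhdsWithin_mono _ fun x hx => ne_of_lt hx
  have hKρ : ∀ ρ : {w : InfinitePlace L // IsComplex w} → Perm (Fin 3), (K ρ : ℂ) =
      ((∏ v : {w : InfinitePlace L // IsComplex w}, ((SignType.sign ((v.1.embedding (α ((ρ v).symm 1))).re) : ℤ) * archMajoritySign L (Matrix.diagonal α) v) : ℤ) : ℂ) :=
    fun ρ => by rw [hK ρ]
  have hHp : Tendsto (fun ψ => ∑ ρ : {w : InfinitePlace L // IsComplex w} → Perm (Fin 3), (K ρ : ℂ) * G ρ ψ) (𝓝[>] 0)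
      (𝓝 (∑ ρ : {w : InfinitePlace L // IsComplex w} → Perm (Fin 3),
        ((∏ v : {w : InfinitePlace L // IsComplex w}, ((SignType.sign ((v.1.embedding (α ((ρ v).symm 1))).re) : ℤ) * archMajoritySign L (Matrix.diagonal α) v) : ℤ) : ℂ) * Jp ρ)) := by
    refine tendsto_finsetSum _ fun ρ _ => ?_
    rw [← hKρ ρ]
    exact (hJp' ρ).const_mul _
  have hHm : Tendsto (fun ψ => ∑ ρ : {w : InfinitePlace L // IsComplex w} → Perm (Fin 3), (K ρ : ℂ) * G ρ ψ) (𝓝[<] 0)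
      (𝓝 (∑ ρ : {w : InfinitePlace L // IsComplex w} → Perm (Fin 3),
        ((∏ v : {w : InfinitePlace L // IsComplex w}, ((SignType.sign ((v.1.embedding (α ((ρ v).symm 1))).re) : ℤ) * archMajoritySign L (Matrix.diagonal α) v) : ℤ) : ℂ) * Jm ρ)) := by
    refine tendsto_finsetSum _ fun ρ _ => ?_
    rw [← hKρ ρ]
    exact (hJm' ρ).const_mul _
  rw [← hS0v]
  exact ⟨(hS0.mono_left hGT).mul hHp, (hS0.mono_left hLT).mul hHm⟩

omit [BorelSpace (GL (Fin 3) ℂ)] [BorelSpace (arch (↥(maximalRealSubfield L)) L (IsCMField.complexConj L) 3 (Matrix.diagonal α))] in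
include hγH in
open scoped Classical in
/-- **(M3-link) — THE ONE-SIDED LIMITS OF `2 sin ψ · (Δ″-side)` AT THE `H`-WALL FROM THE PARTNERS' ONE-SIDED LIMITS.**  Base `z` with `z_{w,0} = z_{w,2}` (no regularity needed: pure algebra on the limits),
`μ|_{𝔸_{L⁺}^×} = ω`; if `g_ρ(ψ) = 2 sin ψ·∫_{G′_∞} Θ(↑↑(g·t(z^ψ∘ρ)·g⁻¹)) dν_∞ → Jp_ρ` (`ψ → 0+`) and `→ Jm_ρ` (`ψ → 0−`) for every `ρ`, then
`G(ψ) = 2 sin ψ · Σ_ρ Δ″(γ_H(z^ψ), t(z^ψ∘ρ))·∫…  → (τ(γ_H z)·D_{G∕H,∞}(γ_H z)) · Σ_ρ K_ρ Jp_ρ` (`0+`), resp. `… Σ_ρ K_ρ Jm_ρ` (`0−`), `K_ρ = Π_v sgn(re σ_v α_{ρ_v⁻¹1})·η_v`.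
[cite: Rogawski1990, §8.2 pp. 122–124; §4.9 p. 55] [cite: Shelstad1979, §4] [cite: Varadarajan1989, §6.4 Thm 18, Thm 20, Thm 22] -/
theorem tendsto_two_sin_mul_sum_archExplicitDelta_mul_integral_splitCurve_hWall_of_tendsto
    (νw : ∀ v : {w : InfinitePlace L // IsComplex w}, Measure (archLocal L 3 (Matrix.diagonal α) v)) [∀ v, (νw v).IsHaarMeasure]
    (hμω : ∀ x : ideleGroup ↥(maximalRealSubfield L), μ (AdeleRing.ideleBaseChange (↥(maximalRealSubfield L)) L x) = quadraticHeckeCharCM L x)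
    (Θ : Matrix (Fin 3) (Fin 3) (mixedSpace L) → ℂ)
    (z : {w : InfinitePlace L // IsComplex w} → Fin 3 → Circle) (h02 : z w 0 = z w 2)
    (Jp Jm : ({w : InfinitePlace L // IsComplex w} → Perm (Fin 3)) → ℂ)
    (hJp : ∀ ρ : {w : InfinitePlace L // IsComplex w} → Perm (Fin 3), Tendsto (fun ψ : ℝ => (2 * Real.sin ψ : ℂ) *
          ∫ g, Θ (((g * archDiagTorus L 3 α (fun v => Function.update z w (fun i => z w i * Circle.exp (![(1 : ℝ), 0, -1] i * ψ)) v ∘ ⇑(ρ v)) * g⁻¹ :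
            arch (↥(maximalRealSubfield L)) L (IsCMField.complexConj L) 3 (Matrix.diagonal α)) : GL (Fin 3) (mixedSpace L)) : Matrix (Fin 3) (Fin 3) (mixedSpace L))
            ∂((Measure.pi νw).map (archPiEquivCM 3 L (Matrix.diagonal α)).symm)) (𝓝[>] 0) (𝓝 (Jp ρ)))
    (hJm : ∀ ρ : {w : InfinitePlace L // IsComplex w} → Perm (Fin 3), Tendsto (fun ψ : ℝ => (2 * Real.sin ψ : ℂ) *
          ∫ g, Θ (((g * archDiagTorus L 3 α (fun v => Function.update z w (fun i => z w i * Circle.exp (![(1 : ℝ), 0, -1] i * ψ)) v ∘ ⇑(ρ v)) * g⁻¹ :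
            arch (↥(maximalRealSubfield L)) L (IsCMField.complexConj L) 3 (Matrix.diagonal α)) : GL (Fin 3) (mixedSpace L)) : Matrix (Fin 3) (Fin 3) (mixedSpace L))
            ∂((Measure.pi νw).map (archPiEquivCM 3 L (Matrix.diagonal α)).symm)) (𝓝[<] 0) (𝓝 (Jm ρ))) :
    Tendsto (fun ψ : ℝ => (2 * Real.sin ψ : ℂ) * ∑ ρ : {w : InfinitePlace L // IsComplex w} → Perm (Fin 3),
          archExplicitDelta L (Matrix.diagonal α) (γH fun v => Function.update z w (fun i => z w i * Circle.exp (![(1 : ℝ), 0, -1] i * ψ)) v) μ (archDiagTorus L 3 α fun v => Function.update z w (fun i => z w i * Circle.exp (![(1 : ℝ), 0, -1] i * ψ)) v ∘ ⇑(ρ v)) *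
            ∫ g, Θ (((g * archDiagTorus L 3 α (fun v => Function.update z w (fun i => z w i * Circle.exp (![(1 : ℝ), 0, -1] i * ψ)) v ∘ ⇑(ρ v)) * g⁻¹ :
              arch (↥(maximalRealSubfield L)) L (IsCMField.complexConj L) 3 (Matrix.diagonal α)) : GL (Fin 3) (mixedSpace L)) : Matrix (Fin 3) (Fin 3) (mixedSpace L))
              ∂((Measure.pi νw).map (archPiEquivCM 3 L (Matrix.diagonal α)).symm)) (𝓝[>] 0)
        (𝓝 ((archTau L (γH z) μ * (archWeylRatio L (γH z) : ℂ)) * ∑ ρ : {w : InfinitePlace L // IsComplex w} → Perm (Fin 3), ((∏ v : {w : InfinitePlace L // IsComplex w}, ((SignType.sign ((v.1.embedding (α ((ρ v).symm 1))).re) : ℤ) * archMajoritySign L (Matrix.diagonal α) v) : ℤ) : ℂ) * Jp ρ)) ∧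
      Tendsto (fun ψ : ℝ => (2 * Real.sin ψ : ℂ) * ∑ ρ : {w : InfinitePlace L // IsComplex w} → Perm (Fin 3),
          archExplicitDelta L (Matrix.diagonal α) (γH fun v => Function.update z w (fun i => z w i * Circle.exp (![(1 : ℝ), 0, -1] i * ψ)) v) μ (archDiagTorus L 3 α fun v => Function.update z w (fun i => z w i * Circle.exp (![(1 : ℝ), 0, -1] i * ψ)) v ∘ ⇑(ρ v)) *
            ∫ g, Θ (((g * archDiagTorus L 3 α (fun v => Function.update z w (fun i => z w i * Circle.exp (![(1 : ℝ), 0, -1] i * ψ)) v ∘ ⇑(ρ v)) * g⁻¹ :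
              arch (↥(maximalRealSubfield L)) L (IsCMField.complexConj L) 3 (Matrix.diagonal α)) : GL (Fin 3) (mixedSpace L)) : Matrix (Fin 3) (Fin 3) (mixedSpace L))
              ∂((Measure.pi νw).map (archPiEquivCM 3 L (Matrix.diagonal α)).symm)) (𝓝[<] 0)
        (𝓝 ((archTau L (γH z) μ * (archWeylRatio L (γH z) : ℂ)) * ∑ ρ : {w : InfinitePlace L // IsComplex w} → Perm (Fin 3), ((∏ v : {w : InfinitePlace L // IsComplex w}, ((SignType.sign ((v.1.embedding (α ((ρ v).symm 1))).re) : ℤ) * archMajoritySign L (Matrix.diagonal α) v) : ℤ) : ℂ) * Jm ρ)) :=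
  tendsto_two_sin_mul_sum_archExplicitDelta_mul_integral_splitCurve_hWall_of_tendsto_aux L α w γH hγH μ νw hμω Θ z h02 _ rfl Jp Jm hJp hJm

end HWall

end Literature.NumberTheory.Rogawski1990

end
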